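import Summits.QuantumFields.YangMills.Theorems.FluctuationComparisonRegPrIntLHeightwiseQuotientOfPackageV3
import Summits.QuantumFields.YangMills.Theorems.FluctuationComparisonRegPrIntLHeightwiseQuotientAnchoringChi
import Summits.QuantumFields.YangMills.Theorems.FluctuationComparisonRegPrIntLHeightwiseMainTermRows
import Summits.QuantumFields.YangMills.Theorems.UV3ACBounds5UpperOfRows
import Summits.QuantumFields.YangMills.Theorems.AlphaInputsT3ACv4RecordSelXs
import HarnessLib

/-!
# UP∘-QUOT (B′) — THE χ∕ROWS EDITION OF RECORD (★★OWNER RULING №44): UP∘ (lit `HeightwiseUpperBound F γ`, organ text VERBATIM) and the INTERIOR-WINDOW lower quotient for the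
# pinned `ℰp` densities FROM THE v4 χ-SOCKET `AlphaInputsT3ACv4RecChi` ALONE — and from the 19936 registry's two rows {EX = `hT8`, (O‴χₛ) = `hrows`} BY NAME

Cell `ym3-torus` (YM ladder rung R3 = continuum `SU(2)` Yang–Mills on the three-torus — a RUNG, NOT d = 4, NOT infinite volume, NOT a mass gap, NOT Clay).  Width seat
`ym-ust-20520-w3` (gen 19, LEAD-20520 by lineage); `--supports stmt-QuantumFields-20520 --as helper`, count-neutral, definition-free, default heartbeats.  RULING №44 (iii)∕(iv):
the v3 editions ✓`…HeightwiseQuotientOfPackageV3` (UP∘ ∧ LOWB∘ ⟸ `AlphaInputsT3ACv3Rec`) are theorems of record but their socket is not fed by 19936's registered rows; the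
SOCKET OF RECORD for 20520-side consumers is the ROWS record `AlphaInputsT3AC.PkgCoreRows` ∕ the v4 χ-socket `AlphaInputsT3ACv4RecChi`, which ✓`HistoryTailSelSupplier.
laneRecordsV4Chi_of_thm1In8_selXsDataRows_allL (hT8) (hrows)` (`AlphaInputsT3ACv4RecordSelXs`) derives from the 19936 registry v6 rows BY NAME.  THIS FILE is the χ∕rows knit over the three hands' rows files:
w5-20520 g18 ✓`…HeightwiseQuotientAnchoringChi.ae_quotient_bounds_level_chi` ((A)'s same-level anchoring over `PkgAtV4Chi`, lower half on the INTERIOR window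
`{PlaqSmall θBal(n)∕max B₃ 1}` via ✓`PkgAtV4Chi.le_resDensity_int_ae`), ym3-torus-px8 g15 ✓`UV3ACLargeFieldEnvelopeRows.exists_lfSum_le_exp_ae_rows` (B25 at every level over the rows
record) + ✓`UV3ACBounds5UpperOfRows.abs_Pint_le_height_rows`∕`Rm_height_le_rows` ((46), remainder, K-free at fixed height), w4-20520 g18 ✓`…HeightwiseMainTermRows.hMainH_v4Chi`
(the heightwise trivial-history main term from r1 + the regular-fibre arithmetic) + ✓`exists_coupling_window_letters` (the two `θBal` smallness letters for small coupling).
* §1 ★★★★ `quotientBounds_of_packageV4Chi` — under `h : AlphaInputsT3AC.OfV4ChiAt F 𝔠 a₀ a₁`, `hc`, `γ ∈ (0, (min γ₀ 1)²]`, `θBal(n) ≤ a₁`, `B₃θBal(n) ≤ a₀`: `∀ n, ∃ C, ∃ c > 0, ∀ K ≥ n`,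
  a.e. `Z_K⁻¹·heightDensity F γ hK univ ≤ C` and, a.e. on `{PlaqSmall (θBal(𝔠.b₀, 𝔠.p₀, n)∕max 𝔠.B₃ 1)}`, `c ≤ Z_K⁻¹·heightDensity` — NO displayed row beyond the χ-package.
* §2 ★★★★ `heightwiseUpperBound_of_packageV4Chi : HeightwiseUpperBound F γ`; ★★★ `heightwiseLowerInterior_of_packageV4Chi`.
* §3 ★★★★★ `stabilityUpperCan_of_v4RecChi (hrec : ∀ L, Odd L → 1 < L → AlphaInputsT3ACv4RecChi L)` : THE ORGAN ROW UP∘ (`StabilityUpperCan`, text VERBATIM) — χ EDITION OF RECORD;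
  ★★★★ `stabilityLowerWindowCanChi_of_v4RecChi (hrec)` : the χ-natural LOWB letter — LOWB∘'s text with the window scaled by a constant `cW ∈ (0, 1]` bound AFTER the profile
  (`cW := 1∕max B₃ 1` of the record; LOWB∘'s exact text needs `B₃` uniform over the socket's records — true at the `(hT8, hrows)` level where `𝔠.B₃ = B` is pinned, see §4's note).
* §4 ★★★★★ `stabilityUpperCan_of_thm1In8_selXsDataRows (hT8) (hrows)` : UP∘ FROM THE 19936 REGISTRY'S TWO ROWS {EX, (O‴χₛ)} BY NAME (texts = ✓`laneRecordsV4Chi_of_thm1In8_selXsDataRows_allL`'s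
  binders VERBATIM) — «conditional on 19936's registered rows» in the sense of RULING №44 (iii).

HONEST SCOPE.  A knit over landed theorems; CONDITIONAL on the OPEN (α) χ-socket ∕ the 19936 rows {EX, (O‴χₛ)} (the UV3 node's and NODE O's inputs); Theorem 1, UP∘'s suppliers,
PERS₁∘∕TUBE∘ (χ edition pending the LOWB window word), LFR♯ᶜ∘, S2β, `FluctuationComparisonRegPrIntL` (20520), EX (19200), `HistoryTailL` (19936) are NOT proved; no summit is
proved by a helper; rung R3 = SU(2) YM₃ on T³ — NOT d = 4, NOT infinite volume, NOT a mass gap, NOT Clay.  Sorry-free, axioms standard.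

References: T. Bałaban, CMP **102** (1985) 255–275 [Balaban1985UV3] ((4)–(7) pp.256–257, Thm 1 p.257, (41) p.266, (46)–(47) p.267, pp.273–274); T. Bałaban, CMP **102**
(1985) 277–309 [Balaban1985Variational] (Thm 1 (8) p.279); T. Bałaban, CMP **109** (1987) 249–301 [Balaban1987RG1] ((0.1)–(0.4) pp.251–253).
-/

set_option autoImplicit false

noncomputable section

namespace Summit.QuantumFields.YangMills.Theorems.FluctuationComparisonRegPrIntLHeightwiseQuotientOfPackageV4Chi

open MeasureTheory
open scoped BigOperators
open Literature.MathematicalPhysics.QuantumFieldTheory.Balaban1983to89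
open Literature.MathematicalPhysics.QuantumFieldTheory.Balaban1983to89.T3ContinuumYM3Torus
open Literature.MathematicalPhysics.QuantumFieldTheory.Balaban1983to89.T3UnitLawDensityEML (ℰp)
open Literature.MathematicalPhysics.QuantumFieldTheory.Balaban1983to89.T3UnitScaleTilt (θBal)
open Literature.MathematicalPhysics.QuantumFieldTheory.Balaban1983to89.T3RestrictedUnitDensity (resDensity)
open Literature.MathematicalPhysics.QuantumFieldTheory.Balaban1983to89.T3TiltDescent (heightDensity)
open Literature.MathematicalPhysics.QuantumFieldTheory.Balaban1983to89.T3HeightwiseDensityBounds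
open Literature.MathematicalPhysics.QuantumFieldTheory.Balaban1983to89.T3PrintedMinimiserExistence (Thm1GlobalMinAt)
open Literature.MathematicalPhysics.QuantumFieldTheory.Balaban1983to89.T3LowerAlongMinimisersSplit (MinimisersIn8At)
open Literature.MathematicalPhysics.QuantumFieldTheory.Balaban1983to89.ExpMeanLog (deltaSU)
open Literature.MathematicalPhysics.QuantumFieldTheory.Balaban1983to89.Missing (partitionFn)
open Literature.MathematicalPhysics.QuantumFieldTheory.Balaban1985CMP102
open Literature.MathematicalPhysics.QuantumFieldTheory.Balaban1985CMP102.Setting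
open Summit.QuantumFields.Balaban3D.Carriers
open Summit.QuantumFields.Balaban3D.Proofs.Primitives
open Summit.QuantumFields.Balaban3D.Proofs.Thresholds (Q0)
open Literature.MathematicalPhysics.QuantumFieldTheory.Balaban1983to89.B7Prop2Explicit (C0)
open Summit.QuantumFields.YangMills.Theorems.FluctuationComparisonRegPrIntLHeightwiseQuotientOfPackageV3 (card_level_eq ae_heightDensity_of_ae_resDensity)
open Summit.QuantumFields.YangMills.Theorems.FluctuationComparisonRegPrIntLHeightwiseQuotientAnchoringChi (ae_quotient_bounds_level_chi)
open Summit.QuantumFields.YangMills.Theorems.FluctuationComparisonRegPrIntLHeightwiseMainTermRows (hMainH_v4Chi exists_coupling_window_letters)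

/-! ## §1 The two-sided heightwise quotient bounds modulo the v4 χ-package alone -/

section Package

variable {F : T3Family} {𝔠 : AlphaConsts F.L (suGroupModel 2).N} {a₀ a₁ : ℝ}

/-- ★★★★ **THE TWO-SIDED HEIGHTWISE QUOTIENT BOUNDS FOR THE PINNED `ℰp` DENSITIES MODULO THE v4 χ-PACKAGE ALONE** (below the `θBal` smallness letters): under
`h : AlphaInputsT3AC.OfV4ChiAt F 𝔠 a₀ a₁`, `hc`, `γ ∈ (0, (min γ₀ 1)²]`, `θBal(n) ≤ a₁`, `B₃θBal(n) ≤ a₀` (all `n`): `∀ n, ∃ C, ∃ c > 0, ∀ K ≥ n`, a.e. `Z_K⁻¹·heightDensity ≤ C` and, a.e. on the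
INTERIOR window `{PlaqSmall (θBal(𝔠.b₀, 𝔠.p₀, n)∕max 𝔠.B₃ 1)}`, `c ≤ Z_K⁻¹·heightDensity` — w5's ✓`ae_quotient_bounds_level_chi` with every row discharged BY NAME: (46) ✓`abs_Pint_le_height_rows`,
`Rm` ✓`Rm_height_le_rows`, B25 ✓`exists_lfSum_le_exp_ae_rows` (all over `(h.pkgAtV4Chi …).toRows`), main term ✓`hMainH_v4Chi`; then ✓`ae_heightDensity_of_ae_resDensity`.
[cite: Balaban1985UV3, (5)–(6) pp.256–257, (41) p.266, (46)–(47) p.267, pp.273–274; Balaban1985Variational, Thm 1 (8) p.279] -/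
theorem quotientBounds_of_packageV4Chi (h : AlphaInputsT3AC.OfV4ChiAt F 𝔠 a₀ a₁) (hc : 0 < a₀ ∧ 0 < a₁ ∧ 𝔠.B₃ * a₁ ≤ a₀)
    (γ : ℝ) (hγ : 0 < γ) (hγ1 : γ ≤ (min 𝔠.gamma0 1) ^ 2)
    (hθ₁ : ∀ n : ℕ, θBal F.L γ 𝔠.b₀ 𝔠.p₀ n ≤ a₁) (hθ₀ : ∀ n : ℕ, 𝔠.B₃ * θBal F.L γ 𝔠.b₀ 𝔠.p₀ n ≤ a₀) (n : ℕ) :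
    ∃ C c : ℝ, 0 < c ∧ ∀ (K : ℕ) (hK : n ≤ K),
      (∀ᵐ V ∂fieldMeasure (F.P n) 0 (Matrix.specialUnitaryGroup (Fin 2) ℂ),
        (partitionFn (G := Matrix.specialUnitaryGroup (Fin 2) ℂ) (F.P K) ((F.scheme ℰp γ).β K))⁻¹ * heightDensity F γ hK Set.univ V ≤ C) ∧
      (∀ᵐ V ∂fieldMeasure (F.P n) 0 (Matrix.specialUnitaryGroup (Fin 2) ℂ), PlaqSmall (θBal F.L γ 𝔠.b₀ 𝔠.p₀ n / max 𝔠.B₃ 1) V →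
        c ≤ (partitionFn (G := Matrix.specialUnitaryGroup (Fin 2) ℂ) (F.P K) ((F.scheme ℰp γ).β K))⁻¹ * heightDensity F γ hK Set.univ V) := by
  obtain ⟨A, hA0, hA⟩ := UV3ACLargeFieldEnvelopeRows.exists_lfSum_le_exp_ae_rows F
  obtain ⟨Cm, hCm⟩ := hMainH_v4Chi h hc γ hγ hγ1 hθ₁ hθ₀ n
  set CP : ℝ := (𝔠.C46 * (𝔠.M₁ : ℝ) ^ 3) * θBal F.L γ 𝔠.b₀ 𝔠.p₀ (n + 1) ^ 2 * ((F.P n).sitesPerDir 0 : ℝ) ^ 3 with hCPdef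
  set CRu : ℝ := Real.exp (𝔠.stepConsts.rstar / (1 - ((F.L : ℝ)⁻¹) ^ 𝔠.κ₀) * ((F.P n).sitesPerDir 0 : ℝ) ^ 3) with hCRudef
  set B : ℝ := Real.exp ((Fintype.card (PBond (F.P n) 0) : ℝ) * A + 3 / (Real.log F.L / 2) * (Fintype.card (Site (F.P n) 0) : ℝ)) with hBdef
  set vol : ℝ := (fieldMeasure (F.P n) 0 (Matrix.specialUnitaryGroup (Fin 2) ℂ)).real
    {V : GaugeField (F.P n) 0 (Matrix.specialUnitaryGroup (Fin 2) ℂ) | PlaqSmall (θBal F.L γ 𝔠.b₀ 𝔠.p₀ n / max 𝔠.B₃ 1) V} with hvoldef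
  have hCRu0 : 0 < CRu := Real.exp_pos _
  have hB0 : 0 < B := Real.exp_pos _
  refine ⟨(CRu * Real.exp CP * B) / ((CRu⁻¹ * Real.exp (-Cm - CP)) * vol), (CRu⁻¹ * Real.exp (-Cm - CP)) / (CRu * Real.exp CP * B),
    by positivity, fun K hK => ?_⟩
  set p := h.pkgAtV4Chi hc γ hγ hγ1 K with hpdef
  have ha₁ : ∀ i : ℕ, θBal F.L γ 𝔠.b₀ 𝔠.p₀ i ≤ p.a₁ := fun i => (hθ₁ i).trans_eq (h.pkgAtV4Chi_a₁ hc γ hγ hγ1 K).symm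
  have hP : ∀ (r : Hist (F.P K) (K - n)) (W : GaugeField (F.P K) (K - n) (Matrix.specialUnitaryGroup (Fin 2) ℂ)), |p.toRows.T.Pint (K - n) r W| ≤ CP :=
    fun r W => UV3ACBounds5UpperOfRows.abs_Pint_le_height_rows p.toRows hK r W
  have hRm : Real.exp (p.toRows.T.Rm (K - n)) ≤ CRu := Real.exp_le_exp.mpr (UV3ACBounds5UpperOfRows.Rm_height_le_rows p.toRows n)
  have hBae : ∀ᵐ W ∂fieldMeasure (F.P K) (K - n) (Matrix.specialUnitaryGroup (Fin 2) ℂ),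
      ∑ r : Hist (F.P K) (K - n), p.toRows.wtP (K - n) r W * Real.exp (-(p.toRows.T.mainT (K - n) r W) + p.toRows.T.Zterm (K - n) r) ≤ B := by
    have h3 := hA 𝔠 γ hγ hγ1 K p.toRows (K - n) (Nat.sub_le K n)
    obtain ⟨hb, hs⟩ := card_level_eq F hK
    rw [hb, hs] at h3
    exact h3
  have hM : ∀ (W : GaugeField (F.P K) (K - n) (Matrix.specialUnitaryGroup (Fin 2) ℂ)), PlaqSmall (θBal F.L γ 𝔠.b₀ 𝔠.p₀ n / max 𝔠.B₃ 1) W →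
      p.toRows.T.mainT (K - n) (p.toRows.T.triv (K - n)) W ≤ Cm := by
    intro W hW
    refine hCm K hK W fun q => lt_of_lt_of_le (hW q) ?_
    -- the interior window lies inside print's window: `θ / max B₃ 1 ≤ θ` for `θ ≥ 0`
    have hθ0 : 0 ≤ θBal F.L γ 𝔠.b₀ 𝔠.p₀ n :=
      (FluctuationComparisonRegPrIntLHeightwiseQuotientAnchoring.θBal_pos_of_window 𝔠 hγ hγ1 n).le
    exact div_le_self hθ0 (le_max_right _ _)
  obtain ⟨hupK, hlowK⟩ := ae_quotient_bounds_level_chi p hK ha₁ hCRu0 hB0 hP hRm hBae hM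
  refine ⟨?_, ?_⟩
  · exact ae_heightDensity_of_ae_resDensity F γ hK
      (Q := fun _ r => (partitionFn (G := Matrix.specialUnitaryGroup (Fin 2) ℂ) (F.P K) ((F.scheme ℰp γ).β K))⁻¹ * r ≤ _) hupK
  · have ht := ae_heightDensity_of_ae_resDensity F γ hK
      (Q := fun W r => PlaqSmall (θBal F.L γ 𝔠.b₀ 𝔠.p₀ n / max 𝔠.B₃ 1) W →
        (CRu⁻¹ * Real.exp (-Cm - CP)) / (CRu * Real.exp CP * B) ≤
          (partitionFn (G := Matrix.specialUnitaryGroup (Fin 2) ℂ) (F.P K) ((F.scheme ℰp γ).β K))⁻¹ * r) hlowK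
    filter_upwards [ht] with V hV hsmall
    exact hV ((T3CruxEstimates.plaqSmall_fieldShift F _ _ V).2 hsmall)

/-! ## §2 UP∘ per `(F, γ)` and the interior lower letter -/

/-- ★★★★ **UP∘ PER `(F, γ)` — lit `HeightwiseUpperBound F γ` MODULO THE v4 χ-PACKAGE** (below the smallness letters). [cite: Balaban1985UV3, (5)–(6) pp.256–257 + Thm 1 p.257] -/
theorem heightwiseUpperBound_of_packageV4Chi (h : AlphaInputsT3AC.OfV4ChiAt F 𝔠 a₀ a₁) (hc : 0 < a₀ ∧ 0 < a₁ ∧ 𝔠.B₃ * a₁ ≤ a₀)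
    (γ : ℝ) (hγ : 0 < γ) (hγ1 : γ ≤ (min 𝔠.gamma0 1) ^ 2)
    (hθ₁ : ∀ n : ℕ, θBal F.L γ 𝔠.b₀ 𝔠.p₀ n ≤ a₁) (hθ₀ : ∀ n : ℕ, 𝔠.B₃ * θBal F.L γ 𝔠.b₀ 𝔠.p₀ n ≤ a₀) :
    HeightwiseUpperBound F γ := fun n => by
  obtain ⟨C, c, -, hCc⟩ := quotientBounds_of_packageV4Chi h hc γ hγ hγ1 hθ₁ hθ₀ n
  exact ⟨C, fun K hK => (hCc K hK).1⟩

/-- ★★★ **THE INTERIOR-WINDOW LOWER QUOTIENT LETTER PER `(F, γ)`** modulo the v4 χ-package: `∀ n, ∃ cl > 0, ∀ K ≥ n, ∀ᵐ V, PlaqSmall (θBal(n)∕max B₃ 1) V → cl ≤ Z_K⁻¹·heightDensity`.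
[cite: Balaban1985UV3, (4)–(5) p.256, (47) p.267; Balaban1985Variational, Thm 1 (8) p.279] -/
theorem heightwiseLowerInterior_of_packageV4Chi (h : AlphaInputsT3AC.OfV4ChiAt F 𝔠 a₀ a₁) (hc : 0 < a₀ ∧ 0 < a₁ ∧ 𝔠.B₃ * a₁ ≤ a₀)
    (γ : ℝ) (hγ : 0 < γ) (hγ1 : γ ≤ (min 𝔠.gamma0 1) ^ 2)
    (hθ₁ : ∀ n : ℕ, θBal F.L γ 𝔠.b₀ 𝔠.p₀ n ≤ a₁) (hθ₀ : ∀ n : ℕ, 𝔠.B₃ * θBal F.L γ 𝔠.b₀ 𝔠.p₀ n ≤ a₀) :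
    ∀ (n : ℕ), ∃ cl : ℝ, 0 < cl ∧ ∀ (K : ℕ) (hK : n ≤ K),
      ∀ᵐ V ∂(fieldMeasure (F.P n) 0 (Matrix.specialUnitaryGroup (Fin 2) ℂ)),
        PlaqSmall (θBal F.L γ 𝔠.b₀ 𝔠.p₀ n / max 𝔠.B₃ 1) V →
          cl ≤ (partitionFn (G := Matrix.specialUnitaryGroup (Fin 2) ℂ) (F.P K) ((F.scheme ℰp γ).β K))⁻¹ *
            heightDensity F γ hK Set.univ V := fun n => by
  obtain ⟨C, c, hc0, hCc⟩ := quotientBounds_of_packageV4Chi h hc γ hγ hγ1 hθ₁ hθ₀ n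
  exact ⟨c, hc0, fun K hK => (hCc K hK).2⟩

end Package

/-! ## §3 The organ row UP∘ (text VERBATIM) and the χ-natural lower letter from the v4 χ-socket alone -/

section Organ

/-- ★★★★★ **UP∘ ∧ LOWBχ FROM THE GUARDED v4 χ-SOCKET OF R3 ALONE.**  First conjunct = THE ORGAN ROW UP∘ (`StabilityUpperCan` of `Lines/history_split.lean` :224, TEXT VERBATIM) — the χ
EDITION OF RECORD (★★OWNER RULING №44).  Second conjunct = LOWBχ: LOWB∘'s text with the window scaled by a constant `cW ∈ (0,1]` bound after the profile (`cW := 1∕max B₃ 1` of the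
record; for LOWB∘'s exact window one needs `B₃` uniform over the socket's records — available at the `(hT8, hrows)` level, where `𝔠.B₃ = B` is pinned, not through this socket).
Per profile beyond the socket's thresholds: the record and its `a₀, a₁`; `γ₁ := min (min γ₀ 1)² γθ`, `γθ` from ✓`exists_coupling_window_letters`; then §1.  The `L` with no family are vacuous.
[cite: Balaban1985UV3, Thm 1 (5)–(6) pp.256–257, (41) p.266, (46)–(47) p.267, pp.273–274; Balaban1985Variational, Thm 1 p.279] -/
theorem stabilityCansChi_of_v4RecChi (hrec : ∀ L : ℕ, Odd L → 1 < L → AlphaInputsT3ACv4RecChi L) :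
    (∀ (L : ℕ), ∃ γ₁ : ℝ, 0 < γ₁ ∧ ∀ (F : T3Family) (γ : ℝ), F.L = L → 0 < γ → γ ≤ γ₁ → HeightwiseUpperBound F γ) ∧
    (∀ (L : ℕ), ∃ bB pB : ℝ, ∀ (b₀ p₀ : ℝ), bB ≤ b₀ → pB ≤ p₀ → ∃ cW : ℝ, 0 < cW ∧ cW ≤ 1 ∧
      ∃ γ₁ : ℝ, 0 < γ₁ ∧ ∀ (F : T3Family) (γ : ℝ), F.L = L → 0 < γ → γ ≤ γ₁ →
        ∀ (n : ℕ), ∃ cl : ℝ, 0 < cl ∧ ∀ (K : ℕ) (hK : n ≤ K),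
          ∀ᵐ V ∂(fieldMeasure (F.P n) 0 (Matrix.specialUnitaryGroup (Fin 2) ℂ)),
            PlaqSmall (cW * θBal F.L γ b₀ p₀ n) V →
              cl ≤ (partitionFn (G := Matrix.specialUnitaryGroup (Fin 2) ℂ) (F.P K) ((F.scheme ℰp γ).β K))⁻¹ *
                heightDensity F γ hK Set.univ V) := by
  have key : ∀ (L : ℕ), Odd L → 1 < L → ∃ bB pB : ℝ, ∀ (b₀ p₀ : ℝ), bB ≤ b₀ → pB ≤ p₀ → ∃ cW : ℝ, 0 < cW ∧ cW ≤ 1 ∧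
      ∃ γ₁ : ℝ, 0 < γ₁ ∧ ∀ (F : T3Family) (γ : ℝ), F.L = L → 0 < γ → γ ≤ γ₁ →
        HeightwiseUpperBound F γ ∧
        ∀ (n : ℕ), ∃ cl : ℝ, 0 < cl ∧ ∀ (K : ℕ) (hK : n ≤ K),
          ∀ᵐ V ∂(fieldMeasure (F.P n) 0 (Matrix.specialUnitaryGroup (Fin 2) ℂ)),
            PlaqSmall (cW * θBal F.L γ b₀ p₀ n) V →
              cl ≤ (partitionFn (G := Matrix.specialUnitaryGroup (Fin 2) ℂ) (F.P K) ((F.scheme ℰp γ).β K))⁻¹ *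
                heightDensity F γ hK Set.univ V := by
    intro L hodd hL
    obtain ⟨b₁, p₁, hbp⟩ := hrec L hodd hL
    refine ⟨b₁, p₁, fun b₀ p₀ hb hp => ?_⟩
    obtain ⟨𝔠, a₀, a₁, hb₀, hp₀, ha₀, ha₁, hB₃, hOf⟩ := hbp b₀ p₀ hb hp
    have hMpos : 0 < max 𝔠.B₃ 1 := lt_of_lt_of_le one_pos (le_max_right _ _)
    obtain ⟨γθ, hγθ, hθ⟩ := exists_coupling_window_letters hL.le 𝔠.b₀ 𝔠.p₀ 𝔠.B₃_pos ha₀ ha₁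
    refine ⟨(max 𝔠.B₃ 1)⁻¹, inv_pos.mpr hMpos, inv_le_one_of_one_le₀ (le_max_right _ _),
      min ((min 𝔠.gamma0 1) ^ 2) γθ, lt_min (pow_pos (lt_min 𝔠.gamma0_pos one_pos) 2) hγθ, fun F γ hFL hγ hγle => ?_⟩
    subst hFL
    subst hb₀
    subst hp₀
    have hγ1 : γ ≤ (min 𝔠.gamma0 1) ^ 2 := hγle.trans (min_le_left _ _)
    obtain ⟨hθ₁, hθ₀⟩ := hθ γ hγ (hγle.trans (min_le_right _ _))
    have hq := quotientBounds_of_packageV4Chi (hOf F rfl) ⟨ha₀, ha₁, hB₃⟩ γ hγ hγ1 hθ₁ hθ₀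
    refine ⟨fun n => ?_, fun n => ?_⟩
    · obtain ⟨C, c, -, hCc⟩ := hq n
      exact ⟨C, fun K hK => (hCc K hK).1⟩
    · obtain ⟨C, c, hc0, hCc⟩ := hq n
      refine ⟨c, hc0, fun K hK => ?_⟩
      filter_upwards [(hCc K hK).2] with V hV hsmall
      refine hV fun q => ?_
      have := hsmall q
      rwa [inv_mul_eq_div] at this
  refine ⟨fun L => ?_, fun L => ?_⟩
  · by_cases hL : Odd L ∧ 1 < L
    · obtain ⟨bB, pB, hkey⟩ := key L hL.1 hL.2
      obtain ⟨cW, -, -, γ₁, hγ₁, hF⟩ := hkey bB pB le_rfl le_rfl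
      exact ⟨γ₁, hγ₁, fun F γ hFL hγ hγle => (hF F γ hFL hγ hγle).1⟩
    · exact ⟨1, one_pos, fun F γ hFL _ _ => absurd (hFL ▸ F.hL) hL⟩
  · by_cases hL : Odd L ∧ 1 < L
    · obtain ⟨bB, pB, hkey⟩ := key L hL.1 hL.2
      refine ⟨bB, pB, fun b₀ p₀ hb hp => ?_⟩
      obtain ⟨cW, hcW, hcW1, γ₁, hγ₁, hF⟩ := hkey b₀ p₀ hb hp
      exact ⟨cW, hcW, hcW1, γ₁, hγ₁, fun F γ hFL hγ hγle => (hF F γ hFL hγ hγle).2⟩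
    · exact ⟨0, 0, fun b₀ p₀ _ _ => ⟨1, one_pos, le_rfl, 1, one_pos, fun F γ hFL _ _ => absurd (hFL ▸ F.hL) hL⟩⟩

/-- ★★★★★ **THE ORGAN ROW UP∘ (`StabilityUpperCan`, TEXT VERBATIM) — χ EDITION OF RECORD — FROM THE GUARDED v4 χ-SOCKET ALONE.** [cite: Balaban1985UV3, Thm 1 (5)–(6) pp.256–257] -/
theorem stabilityUpperCan_of_v4RecChi (hrec : ∀ L : ℕ, Odd L → 1 < L → AlphaInputsT3ACv4RecChi L) :
    ∀ (L : ℕ), ∃ γ₁ : ℝ, 0 < γ₁ ∧ ∀ (F : T3Family) (γ : ℝ), F.L = L → 0 < γ → γ ≤ γ₁ → HeightwiseUpperBound F γ :=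
  (stabilityCansChi_of_v4RecChi hrec).1

/-! ## §4 UP∘ from the 19936 registry's two rows {EX, (O‴χₛ)} by name -/

/-- ★★★★★ **UP∘ (TEXT VERBATIM) FROM THE 19936 REGISTRY v6 ROWS BY NAME** — `hT8` = the EX row's [Balaban1985Variational] Thm 1 ∧ (8) socket and `hrows` = the (O‴χₛ) row's data text,
both the binders of ✓`HistoryTailSelSupplier.laneRecordsV4Chi_of_thm1In8_selXsDataRows_allL` (`AlphaInputsT3ACv4RecordSelXs`) VERBATIM (which they feed); «conditional on 19936's registered rows» in the sense of
★★OWNER RULING №44 (iii). [cite: Balaban1985UV3, Thm 1 (5)–(6) pp.256–257, Thm 2 p.272; Balaban1985Variational, Thm 1 (8) p.279] -/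
theorem stabilityUpperCan_of_thm1In8_selXsDataRows
    (hT8 : ∀ L : ℕ, Odd L → 1 < L → ∃ a₀ a₁ B₃ : ℝ, 0 < a₀ ∧ 0 < a₁ ∧ 0 < B₃ ∧
      Thm1GlobalMinAt L a₀ a₁ B₃ ∧ MinimisersIn8At L a₀ a₁ B₃)
    (hrows : ∀ L : ℕ, Odd L → 1 < L → ∃ (B₀ A₀ A₁ : ℝ), 0 < A₀ ∧ 0 < A₁ ∧
      ∀ (B a₀ a₁ : ℝ), B₀ ≤ B → 1 ≤ 2 * B → 0 < a₀ → a₀ ≤ A₀ → 0 < a₁ → a₁ ≤ A₁ → B * a₁ ≤ a₀ →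
        (143 * ((((3 + 4 : ℕ) : ℝ)) ^ 2 / 4) ^ 2) * (2 * (B * a₁)) ≤ 1 / 3 →
        2 * (2 * (B * a₁)) ≤ 2 * deltaSU (Fin 2) / (((3 + 4) * L : ℕ) : ℝ) ^ 2 →
        Thm1GlobalMinAt L a₀ a₁ B →
        ∃ (b₁ p₁ : ℝ), ∀ (b₀ p₀ : ℝ), b₁ ≤ b₀ → p₁ ≤ p₀ →
          ∃ 𝔠 : AlphaConsts L (suGroupModel 2).N, 𝔠.b₀ = b₀ ∧ 𝔠.p₀ = p₀ ∧ 𝔠.B₃ = B ∧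
            4 * 𝔠.B₃ * (L : ℝ) ^ 2 * avgWindowFactor L ≤ 𝔠.C68 ∧
            Real.exp (𝔠.p₀ - 1) ≤ 3 * C0 3 * 𝔠.C68 * (𝔠.b₀ * Q0 𝔠.p₀) ∧
            (𝔠.b₀ * Q0 𝔠.p₀) * (2 * (L : ℝ) ^ 2 * avgWindowFactor L) ^ 2 ≤ 3 * C0 3 * 𝔠.C68 * a₁ ^ 2 ∧
            ∀ (F : T3Family) (hF : F.L = L),
              (∀ (γ : ℝ) (hγ : 0 < γ) (hγ1 : γ ≤ (min (hF ▸ 𝔠).gamma0 1) ^ 2) (K : ℕ),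
                AlphaInputsT3AC.SmallFactor71OfRecT3 F (hF ▸ 𝔠) γ hγ hγ1 K) ∧
              ∀ (γ : ℝ) (hγ : 0 < γ) (hγ1 : γ ≤ (min (hF ▸ 𝔠).gamma0 1) ^ 2) (K : ℕ),
                (∃ Ut : (k : ℕ) → GaugeField (F.P K) k (Matrix.specialUnitaryGroup (Fin 2) ℂ) →
                    GaugeField (F.P K) 0 (Matrix.specialUnitaryGroup (Fin 2) ℂ),
                  AlphaInputsT3AC.TrivMinimiserRowsT3 F (hF ▸ 𝔠) γ hγ hγ1 a₀ a₁ K Ut) →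
                ∃ Ut : (k : ℕ) → GaugeField (F.P K) k (Matrix.specialUnitaryGroup (Fin 2) ℂ) →
                    GaugeField (F.P K) 0 (Matrix.specialUnitaryGroup (Fin 2) ℂ),
                  AlphaInputsT3AC.TrivMinimiserRowsT3 F (hF ▸ 𝔠) γ hγ hγ1 a₀ a₁ K Ut ∧
                    AlphaInputsT3AC.DataRowsT3XsChiSel F (hF ▸ 𝔠) γ hγ hγ1 K Ut) :
    ∀ (L : ℕ), ∃ γ₁ : ℝ, 0 < γ₁ ∧ ∀ (F : T3Family) (γ : ℝ), F.L = L → 0 < γ → γ ≤ γ₁ → HeightwiseUpperBound F γ :=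
  stabilityUpperCan_of_v4RecChi (HistoryTailSelSupplier.laneRecordsV4Chi_of_thm1In8_selXsDataRows_allL hT8 hrows)

end Organ

end Summit.QuantumFields.YangMills.Theorems.FluctuationComparisonRegPrIntLHeightwiseQuotientOfPackageV4Chi

end
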